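import Literature.AlgebraicGeometry.HodgeTheory.ContinuationAlongLiftedPaths
import Literature.AlgebraicGeometry.HodgeTheory.QbarFamilyLocalSystem
import Literature.AlgebraicGeometry.HodgeTheory.InvariantClassesFromTotalSpaceProofs
import Summits.HodgeConjecture.HodgeConjecture.Theses.LinearSystemTorelli
import HarnessLib

/-!
# Route `LinearSystemTorelli` — crux `MiddleDivisorSupportFourfold` (stmt-HodgeConjecture-2409), line
`IdeatorFiveSketch`: the transfer kernel A'' holds for classes that extend over a cover of a Zariski
open neighbourhood of the generic point

Helper file for the crux item stmt-HodgeConjecture-2409 (`--supports`; it closes nothing). The line's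
registered transcendence kernel is the stub A'' `stub_typeStabilityAtQbarGenericZariskiLocal`
(skeleton v16–v18): for the complexification `f = f₀ ⊗_σ ℂ` of a smooth projective `ℚ̄`-family of
fourfolds over a smooth irreducible quasi-projective `S₀`, a complex point `s` over the generic point
of `S₀` and a rational `(2,2)`-class `α` on `𝒳_s`, SOME proper Zariski-closed `Z₀ ⊊ S₀` has the
property that every flat continuation of `α` along a loop at `s` over `S₀ ∖ Z₀` is again of type
`(2,2)`. It is OPEN (Voisin 2007's question whether Hodge loci through `ℚ̄`-generic points are
defined over `ℚ̄`), and implied on paper by HC(4,2) itself: an algebraic `α` is a combination of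
classes of cycles defined over a finite extension of the function field `ℚ̄(S₀)`, which spread to
relative cycles over a finite cover `S₀'` of a dense open `S₀ ∖ Z₀`, étale over it; their classes on
the total space restrict on fibres to algebraic, hence `(2,2)`, classes (Fulton, Ch. 10 / 19;
Voisin II §9.2), and THEN every loop at `s` over `S₀ ∖ Z₀` lifts to the cover and continues `α` to
one of those restrictions. This file kernel-checks the last step — the only one the tree can state
today without a cycle class map for families — in the exact shape of A'':

* `linearSystemTorelli_isOfHodgeType_continuation_of_coverClass` — for ANY `ℂ`-morphism
  `g : S' ⟶ S₀ ⊗_σ ℂ` from a smooth quasi-projective `S'` whose map on complex points is a covering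
  map over `U(ℂ) = {u | u ∉ Z₀}`, and any global class `A ∈ Hᵏ((𝒳 ×_S S')(ℂ); ℂ)` whose fibre
  restriction at a point `s'` transfers to `(s, α)` and whose fibre restrictions over `s` are of type
  `(p,q)`: every continuation of `α` along a loop at `s` over `S₀ ∖ Z₀` is of type `(p,q)`
  (`IsContinuationAlong.isOfHodgeType_of_globalSection_of_isCoveringMapOn` with Ehresmann on both
  families, `isCohomologicallyLocallyTrivialOn_univ_baseChangeHom`,
  `isCohomologicallyLocallyTrivialOn_univ_of_isQuasiProjectiveOver`);
* `linearSystemTorelli_typeStabilityZariskiLocal_of_coverClass` — the conclusion of A'' VERBATIM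
  (`∃ Z₀, IsClosed Z₀ ∧ Z₀ ≠ univ ∧ ∀ γ …`) for `(σ, f₀, s, α)` from such cover data over a proper
  closed `Z₀`.

So inside the line A'' is EXACTLY the statement that every rational `(2,2)`-class at a `ℚ̄`-generic
point extends, over a finite étale cover of a Zariski open neighbourhood of the generic point, to a
global class with `(2,2)` fibre restrictions over `s` — the property HC(4,2) grants through spreading
of cycles; the remaining (unformalised) inputs of "crux ⟹ A''" are listed in the crux's census.
-/

-- every declaration of this problem lives in `Summit.HodgeConjecture.HodgeConjecture.…`
set_option linter.dupNamespace false

noncomputable section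

namespace Summit.HodgeConjecture.HodgeConjecture.Theorems

open CategoryTheory AlgebraicGeometry
open _root_.Topology
open Literature.AlgebraicGeometry Literature.AlgebraicGeometry.Motives
open Literature.AlgebraicGeometry.HodgeTheory
open Literature.AlgebraicTopology.SingularHomology

/-- **Continuations over `S₀ ∖ Z₀` of a class that extends over a cover of `(S₀ ∖ Z₀)(ℂ)` keep its
Hodge type.** Let `f = f₀ ⊗_σ ℂ` be a smooth projective family (relative dimension `n`) over the
complexification of a smooth irreducible quasi-projective `S₀`, `Z₀ ⊆ S₀` any subset,
`g : S' ⟶ S₀ ⊗_σ ℂ` a morphism from a smooth quasi-projective `ℂ`-scheme whose map on complex points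
is a covering map over `{u | u ∉ Z₀}`, and `A ∈ Hᵏ((𝒳 ×_S S')(ℂ); ℂ)` a global class of the base
change with `(s, α)` the transfer of `(s', A|_{X'_{s'}})` and `A|_{X'_{t'}}` of type `(p,q)` for
every `t'` over `s`. Then every flat continuation `β` of `α` along a loop at `s` all of whose points
lie over `S₀ ∖ Z₀` is of type `(p,q)`: both families are cohomologically locally trivial (Ehresmann),
the loop lifts to `S'(ℂ)`, and `(s, β)` is the transfer of some `(t', A|_{X'_{t'}})`
(`IsContinuationAlong.isOfHodgeType_of_globalSection_of_isCoveringMapOn`).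
[cite: Voisin2007HodgeLoci, §3, proof of Prop. 0.7] [cite: VoisinHodgeII2003, §3.1.2] -/
theorem linearSystemTorelli_isOfHodgeType_continuation_of_coverClass
    (σ : AlgebraicClosure ℚ →+* ℂ) ⦃𝒳₀ S₀ : SchemeOver (AlgebraicClosure ℚ)⦄ (f₀ : 𝒳₀ ⟶ S₀)
    (hS₀ : IsQuasiProjectiveOver S₀) [IrreducibleSpace S₀.left] [Smooth S₀.hom] {n : ℕ}
    (hf : IsSmoothProjectiveFamily ((baseChangeHom σ).map f₀) n) (k p q : ℕ) (Z₀ : Set S₀.left)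
    ⦃S' : SchemeOver ℂ⦄ (g : S' ⟶ (baseChangeHom σ).obj S₀) (hS' : IsQuasiProjectiveOver S')
    [Smooth S'.hom]
    (hcov : IsCoveringMapOn (AlgPoints.map g)
      {u : ComplexPoints ((baseChangeHom σ).obj S₀) | (baseChangeHomFst σ S₀).base u.pt ∉ Z₀})
    (A : complexBetti (familyPullback ((baseChangeHom σ).map f₀) g) k)
    {s : ComplexPoints ((baseChangeHom σ).obj S₀)} {s' : ComplexPoints S'}
    {α : complexBetti (fiberOver ((baseChangeHom σ).map f₀) s) k}
    (hα : FiberClass.baseChange ((baseChangeHom σ).map f₀) g k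
      (globalSection (familyPullback.snd ((baseChangeHom σ).map f₀) g) k A s') = ⟨s, α⟩)
    (hA : ∀ t' : ComplexPoints S', AlgPoints.map g t' = s →
      IsOfHodgeType n (fiberOver (familyPullback.snd ((baseChangeHom σ).map f₀) g) t') k p q
        (complexBetti.map (fiberι (familyPullback.snd ((baseChangeHom σ).map f₀) g) t') k A)) :
    ∀ (γ : Path s s), (∀ u, (baseChangeHomFst σ S₀).base (γ u).pt ∉ Z₀) →
      ∀ (β : complexBetti (fiberOver ((baseChangeHom σ).map f₀) s) k),
        IsContinuationAlong γ α β → IsOfHodgeType n (fiberOver ((baseChangeHom σ).map f₀) s) k p q β := by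
  intro γ hγ β hβ
  have hU := isCohomologicallyLocallyTrivialOn_univ_baseChangeHom σ f₀ (n := n) hf hS₀
  have hU' := isCohomologicallyLocallyTrivialOn_univ_of_isQuasiProjectiveOver
    (familyPullback.snd ((baseChangeHom σ).map f₀) g) (hf.familyPullback_snd g) hS' inferInstance
  exact IsContinuationAlong.isOfHodgeType_of_globalSection_of_isCoveringMapOn
    ((baseChangeHom σ).map f₀) g hU hU' k A hcov (fun u ↦ hγ u) hα hA hβ

/-- **The conclusion of the registered stub A'' `stub_typeStabilityAtQbarGenericZariskiLocal`,
VERBATIM, from cover data.** For `σ`, a `ℚ̄`-family `f₀ : 𝒳₀ ⟶ S₀` over a smooth irreducible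
quasi-projective `S₀` with smooth projective complexification of relative dimension `4`, a complex
point `s` and a class `α ∈ H⁴(𝒳_s)`: if over some PROPER Zariski-closed `Z₀ ⊊ S₀` there are a
morphism `g : S' ⟶ S₀ ⊗_σ ℂ` from a smooth quasi-projective `S'` which is a covering map of complex
points over `(S₀ ∖ Z₀)(ℂ)` (e.g. the complexification of a finite étale cover of `S₀ ∖ Z₀`) and a
global class `A ∈ H⁴((𝒳 ×_S S')(ℂ); ℂ)` through `(s, α)` whose fibre restrictions over `s` are
`(2,2)` (e.g. the class of a relative algebraic cycle spread over the cover), then A'' holds at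
`(σ, f₀, s, α)`: `∃ Z₀ ⊊ S₀` closed such that every continuation of `α` along a loop at `s` over
`S₀ ∖ Z₀` is of type `(2,2)`. No genericity of `s`, rationality or type of `α` is needed for this
direction. [cite: Voisin2007HodgeLoci, §3, proof of Prop. 0.7] -/
theorem linearSystemTorelli_typeStabilityZariskiLocal_of_coverClass :
    ∀ (σ : AlgebraicClosure ℚ →+* ℂ) ⦃𝒳₀ S₀ : SchemeOver (AlgebraicClosure ℚ)⦄ (f₀ : 𝒳₀ ⟶ S₀),
      IsQuasiProjectiveOver S₀ → IrreducibleSpace S₀.left → AlgebraicGeometry.Smooth S₀.hom →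
      IsSmoothProjectiveFamily ((baseChangeHom σ).map f₀) 4 →
      ∀ (s : ComplexPoints ((baseChangeHom σ).obj S₀))
        (α : complexBetti (fiberOver ((baseChangeHom σ).map f₀) s) 4) (Z₀ : Set S₀.left),
        IsClosed Z₀ → Z₀ ≠ Set.univ →
        ∀ ⦃S' : SchemeOver ℂ⦄ (g : S' ⟶ (baseChangeHom σ).obj S₀),
          IsQuasiProjectiveOver S' → AlgebraicGeometry.Smooth S'.hom →
          IsCoveringMapOn (AlgPoints.map g)
            {u : ComplexPoints ((baseChangeHom σ).obj S₀) | (baseChangeHomFst σ S₀).base u.pt ∉ Z₀} →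
          ∀ (A : complexBetti (familyPullback ((baseChangeHom σ).map f₀) g) 4) (s' : ComplexPoints S'),
            FiberClass.baseChange ((baseChangeHom σ).map f₀) g 4
              (globalSection (familyPullback.snd ((baseChangeHom σ).map f₀) g) 4 A s') = ⟨s, α⟩ →
            (∀ t' : ComplexPoints S', AlgPoints.map g t' = s →
              IsOfHodgeType 4 (fiberOver (familyPullback.snd ((baseChangeHom σ).map f₀) g) t') 4 2 2
                (complexBetti.map (fiberι (familyPullback.snd ((baseChangeHom σ).map f₀) g) t') 4 A)) →
            ∃ Z₀ : Set S₀.left, IsClosed Z₀ ∧ Z₀ ≠ Set.univ ∧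
              ∀ (γ : Path s s), (∀ u, (baseChangeHomFst σ S₀).base (γ u).pt ∉ Z₀) →
                ∀ (β : complexBetti (fiberOver ((baseChangeHom σ).map f₀) s) 4),
                  IsContinuationAlong γ α β →
                    IsOfHodgeType 4 (fiberOver ((baseChangeHom σ).map f₀) s) 4 2 2 β := by
  intro σ 𝒳₀ S₀ f₀ hS₀ hirr hsm hf s α Z₀ hZ₀ hZ₀' S' g hS' hsm' hcov A s' hα hA
  haveI := hirr
  haveI := hsm
  haveI := hsm'
  exact ⟨Z₀, hZ₀, hZ₀',
    linearSystemTorelli_isOfHodgeType_continuation_of_coverClass σ f₀ hS₀ hf 4 2 2 Z₀ g hS' hcov A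
      hα hA⟩

end Summit.HodgeConjecture.HodgeConjecture.Theorems

end
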